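import Literature.MathematicalPhysics.QuantumFieldTheory.Balaban1983to89.B8SockB9P3H2AtTopCubeTower
import Literature.MathematicalPhysics.QuantumFieldTheory.Balaban1983to89.B8IdxB8SubDRigidity

/-!
# `Balaban1983to89.B8SockB9P3H2AtTopCubeTowerMember` — [Balaban1985RegularSpaces] (1.59) p. 86, (1.5) p. 77, (1.131) p. 99: the socket
# `SockB9P3H2` of Proposition 3's frame AT THE INDEX MEMBERS over print's top-cube tower — the `SB9P` binder's OWN shape
# `∀ i : ZdIdx, … laws … → SockB9P3H2 θ.L B₀ B₀β cP β len i.η i.k i.Ω i.Λs (fun m j => towerBondsP θ.L i.Ω (i.Λs m) j)` restricted to the members with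
# `i.Ω = (T, □₁(a), …, □_k(a))`, and the same on the (1.5)-obeying index of record `Node00.IdxB8SubD θ`

statement-level skeleton of published theorems with citation tags; proofs where landed; nothing here is a claim about the
Yang–Mills mass gap

`[Balaban1985RegularSpaces]` ("B8", CMP **99** (1985) 75–102) (1.3)–(1.6) p. 77, (1.31) p. 82, (1.59) p. 86, (1.68) p. 88, (1.131) p. 99; [B11] =
`[Balaban1985Variational]` (1)–(3) pp. 277–278 (the typed level sets `B11Eq7Convention.Lam`); [4] = `[Balaban1985BackgroundPropagators]` Thm 3.3 p. 399.

CITATION HEADER (lean-in-tree rule).  Cell `pub-ymgap` (YM Track A, HUMAN RULING D-0062 ∕ D-0149), DAG node N05 = [B8], width seat `pub-ymgap-dag-n05-w3`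
(g4), CLAIM-1 file (C).  WHY.  `B8SockB9P3H2AtTopCubeTower.exists_sockB9P3H2_topCube` (file (B)) states the socket at the top-cube tower with the
restriction family DISPLAYED (`Λs k 0 = T ∖ □₁`, `Λs k j = Λ′_j`).  The slot's binder `SB9P` (dag-n05-d `…N05SubBP2DSlotGammaPrime`) quantifies over index
MEMBERS `i : ZdIdx θ.D θ.L` with `i.Ω 0 = T`, the located laws `IdxB8Laws(B)`, (1.3)–(1.4) `DomainSeq` and print's (1.5); by dag-n05-w2's RIGIDITY
(`B8IdxB8SubDRigidity.Λs_eq_lam_of_lamTop` ∕ `IdxB8SubD.Λs_eq_lam`) such a member's restriction family IS [B11]'s `Lam θ.L i.Ω`, and over the top-cube tower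
that family IS the displayed one (§1).  THIS FILE draws the member-level statements.

THE MATHEMATICS (kernel-checked).  §1 DICTIONARY `lamK_cubeFam_true_zero` ∕ `lamK_cubeFam_true_pos`: over `(T, □₁, …, □_k)`, [B11]'s level sets at the top
truncation are `T ∖ □₁` (level `0`) and the member's `cubeLamS … k j` (`1 ≤ j ≤ k`); the ℓ¹ length is an admissible `len` (`one_le_sum_abs_of_ne_zero`).  §2 ★★★ `sockB9P3H2_topCube_lawMember`: ONE triple `(B₀, B₀β, cP)` for the
shape `(L, M, ρ, k)` such that the `SB9P` binder's body holds at EVERY law member `i` with `i.Ω = (T, □₁(a), …, □_k(a))`, `i.k = k` (any position `a`, any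
spacing `i.η`); ★★★ `sockB9P3H2_topCube_idxB8SubD`: the same at every `j : IdxB8SubD θ` over such a tower; ★ `exists_idxB8SubD_sockB9P3H2_topCube`: such members
exist (dag-n05-w2's `exists_idxB8SubD_cubeFam`), so the statement is not vacuous.  §3 `sockB9P3H2_mono` (monotone in the constants) and ★★
`sockB9P3H2_topCube_lawMember_depth`: ONE triple for all depths `1 ≤ k ≤ K` (finite maximum; the constants depend on `K` — bookkeeping for a programme of bounded
depth, NOT [4] Thm 3.3).

HONEST SCOPE ∕ A6 — READ THIS.  Hypotheses displayed: `2 ≤ θ.D`, `θ.L ≤ ρ`, `1 ≤ k`, `0 ≤ β`, `len z ≥ 1` (`z ≠ 0`), and `[FiniteDimensional ℂ θ.𝔸]` (file (U)'s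
compactness route; the record's `θ.𝔸` is an abstract C⋆-algebra — print's `M_N(ℂ)` is finite-dimensional).  The constants depend on the SHAPE `(L, M, ρ, k)`, on `β`,
`θ.D`, `θ.𝔸`, `len` — so this inhabits the `SB9P` binder ON THE SUB-CLASS of top-cube towers of ONE shape, uniformly in position and spacing; it is NOT the binder
over all admissible `{Ω_j}` with one `B₀(d, L)` ([4] Thm 3.3 = N06's object layer) and closes no knit hypothesis as typed.  Count-neutral; N05 NOT discharged; no
count claim; one finite `𝕋⁴` programme at fixed `ε`, Bałaban as printed; the YM mass gap (Clay) is NOT proved by any of this — R4 closes the conditional finite-`𝕋⁴`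
rung `BalabanLadder.UV` only; nothing continuum ∕ ℝ⁴ ∕ OS.  No `sorry`, no `def`, no `instance`, no `notation`.  Unit `pub-ymgap-dag-n05-w3` (g4), 2026-08-28.
-/

noncomputable section

namespace Literature.MathematicalPhysics.QuantumFieldTheory.Balaban1983to89.B8SockB9P3H2AtTopCubeTowerMember

open B7Prop1Explicit B7Prop1Local
open B7Prop4GeneralLevels (linCovIter)
open B8Eq146AExpansion (iEta)
open B8Eq155JBound (Jcur wsup)
open B8ScaledSupNorm (bondNorm)
open B8LeafModelZd (ZdIdx)
open B8ConstraintBonds (DomainSeq Lam)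
open B8Eq131Cubes (cube LamP)
open B8Eq131CubesAdmissible (cubeFam cubeFam_true_zero cubeFam_of_pos smul_mem_Lam_cubeFam_iff smul_mem_cube_iff)
open B8CubeMemberZd (cubeLamS cubeLam cubeLamS_top cubeLamS_self cubeLam_eq_LamP)
open B8TowerBondsPrinted (towerBondsP)
open B9SupplySockB9P3ZdGammaUnivDelta2 (SockB9P3H2)
open B8IdxB8SubDRigidity (mem_lamK_iff_of_lt mem_lamK_self_iff Λs_eq_lam_of_lamTop exists_idxB8SubD_cubeFam)
open B8SockB9P3H2AtTopCubeTower (exists_sockB9P3H2_topCube)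
open Node00 (Stage3Params IdxB8Laws IdxB8SubD)

-- `Site` alone would resolve to the torus sites of `Setup.lean`; re-export the `ℤ^d` sites of `B7Prop1Explicit`.
export B7Prop1Explicit (Site)

variable {d : ℕ}

/-! ## §1 [B11]'s level sets over the top-cube tower at the top truncation -/

/-- **Level `0` over `(T, □₁, …, □_k)` is `T ∖ □₁`** (`k ≥ 1`; (1.131) «Λ′₀ = T ∖ □₁» in [B11] (3)'s typing). [cite: Balaban1985RegularSpaces, (1.131) p.99, (1.5) p.77; Balaban1985Variational, (3) p.278] -/
theorem lamK_cubeFam_true_zero {L : ℕ} (hL : 1 ≤ L) (a : Site d) (M ρ : ℕ) {k : ℕ} (hk : 1 ≤ k) :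
    B11Eq7Convention.Lam L (cubeFam true L a M ρ k) k 0 = (cube L a M ρ k 1)ᶜ := by
  ext y
  rw [mem_lamK_iff_of_lt L _ (show 0 < k by omega), smul_mem_Lam_cubeFam_iff hL a M ρ hk (Nat.zero_le k)]
  simp [LamP]

/-- **The levels `1 ≤ j ≤ k` over `(T, □₁, …, □_k)` are the member's `Λ′_j = cubeLamS … k j`** ([B11] (3) = (1.5) below the top, (1.68) at the top).
[cite: Balaban1985RegularSpaces, (1.131) p.99, (1.5) p.77, (1.68) p.88; Balaban1985Variational, (3) p.278] -/
theorem lamK_cubeFam_true_pos {L : ℕ} (hL : 1 ≤ L) (a : Site d) (M ρ : ℕ) {k j : ℕ} (hj1 : 1 ≤ j) (hjk : j ≤ k) :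
    B11Eq7Convention.Lam L (cubeFam true L a M ρ k) k j = cubeLamS L a M ρ k k j := by
  ext y
  rcases hjk.lt_or_eq with hlt | rfl
  · rw [mem_lamK_iff_of_lt L _ hlt, smul_mem_Lam_cubeFam_iff hL a M ρ (by omega) hjk, cubeLamS_top L a M ρ hjk,
      cubeLam_eq_LamP L a M ρ k hj1]
  · rw [mem_lamK_self_iff, cubeFam_of_pos true L a M ρ hj1 le_rfl, smul_mem_cube_iff hL, cubeLamS_self]
    rfl

/-- **The ℓ¹ length of a lattice displacement is an admissible `len`**: `1 ≤ Σ_i |z_i|` for `z ≠ 0` in `ℤᵈ` (so the normalisation `len z ≥ 1` of file (B) is met by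
the lattice length functions of [4] (3.40)). [cite: Balaban1985BackgroundPropagators, (3.40) p.397] -/
theorem one_le_sum_abs_of_ne_zero {z : Site d} (hz : z ≠ 0) : (1 : ℝ) ≤ ∑ i, |((z i : ℤ) : ℝ)| := by
  obtain ⟨i, hi⟩ := Function.ne_iff.mp hz
  have h1 : (1 : ℝ) ≤ |((z i : ℤ) : ℝ)| := by
    rw [← Int.cast_abs]; exact_mod_cast Int.one_le_abs hi
  exact h1.trans (Finset.single_le_sum (f := fun j => |((z j : ℤ) : ℝ)|) (fun j _ => abs_nonneg _) (Finset.mem_univ i))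

/-! ## §2 The socket at the index members over the top-cube tower -/

/-- ★★★ **THE `SB9P` BINDER'S BODY AT EVERY LAW MEMBER OVER A TOP-CUBE TOWER OF ONE SHAPE.**  For a record `θ` with `θ.D ≥ 2` and finite-dimensional `θ.𝔸`,
a shape `(M, ρ ≥ L, k ≥ 1)`, `β ≥ 0` and a length function with `len z ≥ 1` (`z ≠ 0`): ONE triple `B₀, B₀β, cP > 0` such that for every position `a` and every
index member `i : ZdIdx θ.D θ.L` with `i.Ω = (T, □₁(a), …, □_k(a))`, `i.k = k`, obeying the located laws `IdxB8Laws`, (1.3)–(1.4) `DomainSeq` and print's (1.5)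
— the hypotheses of the slot's binder `SB9P` — the socket `SockB9P3H2 θ.L B₀ B₀β cP β len i.η i.k i.Ω i.Λs (fun m j => towerBondsP θ.L i.Ω (i.Λs m) j)` HOLDS
(any spacing `i.η`).  Rigidity (dag-n05-w2) + §1 + file (B).  Member-dependent constants: NOT [4] Thm 3.3.
[cite: Balaban1985RegularSpaces, (1.59) p.86, (1.5) p.77, (1.131) p.99, (1.31) p.82; Balaban1985BackgroundPropagators, Thm 3.3 p.399; Balaban1985Variational, (3) p.278] -/
theorem sockB9P3H2_topCube_lawMember (θ : Stage3Params) [FiniteDimensional ℂ θ.𝔸] (hD : 2 ≤ θ.D) (M : ℕ) {ρ : ℕ} (hρ : θ.L ≤ ρ)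
    {k : ℕ} (hk : 1 ≤ k) {β : ℝ} (hβ : 0 ≤ β) {len : Site θ.D → ℝ} (hlen : ∀ z : Site θ.D, z ≠ 0 → 1 ≤ len z) :
    ∃ B₀ B₀β cP : ℝ, 0 < B₀ ∧ 0 < B₀β ∧ 0 < cP ∧ ∀ (a : Site θ.D) (i : ZdIdx θ.D θ.L), i.Ω = cubeFam true θ.L a M ρ k → i.k = k →
      IdxB8Laws θ.L i → DomainSeq θ.L i.Ω → (∀ l, l < i.k → ∀ z ∈ i.Λs i.k l, ((θ.L : ℤ) ^ l) • z ∈ Lam θ.L i.Ω l) →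
        SockB9P3H2 (𝔸 := θ.𝔸) θ.L B₀ B₀β cP β len i.η i.k i.Ω i.Λs (fun m j => towerBondsP θ.L i.Ω (i.Λs m) j) := by
  have hL : 1 ≤ θ.L := le_trans (by norm_num) θ.two_le_L
  obtain ⟨B₀, B₀β, cP, hB₀, hB₀β, hcP, H⟩ :=
    exists_sockB9P3H2_topCube (𝔹 := θ.𝔸) hD θ.two_le_L M hρ hk hβ hlen
  refine ⟨B₀, B₀β, cP, hB₀, hB₀β, hcP, fun a i hΩ hkk hlaws hdom h15 => ?_⟩
  have hΛ : ∀ l, l ≤ k → i.Λs k l = B11Eq7Convention.Lam θ.L (cubeFam true θ.L a M ρ k) k l := fun l hl => by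
    have h := Λs_eq_lam_of_lamTop hL i hlaws hdom h15 (m := i.k) le_rfl (l := l) (by rw [hkk]; exact hl)
    rwa [hkk, hΩ] at h
  have hΛ0 : i.Λs k 0 = (cube θ.L a M ρ k 1)ᶜ := by rw [hΛ 0 (Nat.zero_le k), lamK_cubeFam_true_zero hL a M ρ hk]
  have hΛj : ∀ j, 1 ≤ j → j ≤ k → i.Λs k j = cubeLamS θ.L a M ρ k k j := fun j hj1 hjk => by
    rw [hΛ j hjk, lamK_cubeFam_true_pos hL a M ρ hj1 hjk]
  rw [hkk, hΩ]
  exact H a i.η i.hη i.Λs hΛ0 hΛj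

/-- ★★★ **THE SAME AT EVERY MEMBER OF THE (1.5)-OBEYING INDEX OF RECORD `IdxB8SubD θ` OVER A TOP-CUBE TOWER OF ONE SHAPE** (laws, (1.3)–(1.4), (1.5) are the
index's fields; dag-n05-w2's `IdxB8SubD.Λs_eq_lam`). [cite: Balaban1985RegularSpaces, (1.59) p.86, (1.5) p.77, (1.131) p.99; Balaban1985BackgroundPropagators, Thm 3.3 p.399] -/
theorem sockB9P3H2_topCube_idxB8SubD (θ : Stage3Params) [FiniteDimensional ℂ θ.𝔸] (hD : 2 ≤ θ.D) (M : ℕ) {ρ : ℕ} (hρ : θ.L ≤ ρ)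
    {k : ℕ} (hk : 1 ≤ k) {β : ℝ} (hβ : 0 ≤ β) {len : Site θ.D → ℝ} (hlen : ∀ z : Site θ.D, z ≠ 0 → 1 ≤ len z) :
    ∃ B₀ B₀β cP : ℝ, 0 < B₀ ∧ 0 < B₀β ∧ 0 < cP ∧ ∀ (a : Site θ.D) (j : IdxB8SubD θ), j.1.1.1.1.Ω = cubeFam true θ.L a M ρ k → j.1.1.1.1.k = k →
      SockB9P3H2 (𝔸 := θ.𝔸) θ.L B₀ B₀β cP β len j.1.1.1.1.η j.1.1.1.1.k j.1.1.1.1.Ω j.1.1.1.1.Λs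
        (fun m l => towerBondsP θ.L j.1.1.1.1.Ω (j.1.1.1.1.Λs m) l) := by
  obtain ⟨B₀, B₀β, cP, hB₀, hB₀β, hcP, H⟩ := sockB9P3H2_topCube_lawMember θ hD M hρ hk hβ hlen
  exact ⟨B₀, B₀β, cP, hB₀, hB₀β, hcP, fun a j hΩ hkk => H a j.1.1.1.1 hΩ hkk j.1.1.2.toIdxB8Laws j.1.2 j.2⟩

/-- ★ **NON-VACUITY: SUCH MEMBERS EXIST, AND THE SOCKET HOLDS THERE** — at dag-n05-w2's member of `IdxB8SubD θ` over `(T, □₁(a), …, □_k(a))` (spacing `η = L⁻ᵏ`,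
`exists_idxB8SubD_cubeFam`). [cite: Balaban1985RegularSpaces, (1.59) p.86, (1.131) p.99, (1.3)–(1.5) p.77] -/
theorem exists_idxB8SubD_sockB9P3H2_topCube (θ : Stage3Params) [FiniteDimensional ℂ θ.𝔸] (hD : 2 ≤ θ.D) (a : Site θ.D) (M : ℕ) {ρ : ℕ}
    (hρ : θ.L ≤ ρ) {k : ℕ} (hk : 1 ≤ k) {β : ℝ} (hβ : 0 ≤ β) {len : Site θ.D → ℝ} (hlen : ∀ z : Site θ.D, z ≠ 0 → 1 ≤ len z) :
    ∃ B₀ B₀β cP : ℝ, 0 < B₀ ∧ 0 < B₀β ∧ 0 < cP ∧ ∃ j : IdxB8SubD θ, j.1.1.1.1.Ω = cubeFam true θ.L a M ρ k ∧ j.1.1.1.1.k = k ∧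
      SockB9P3H2 (𝔸 := θ.𝔸) θ.L B₀ B₀β cP β len j.1.1.1.1.η j.1.1.1.1.k j.1.1.1.1.Ω j.1.1.1.1.Λs
        (fun m l => towerBondsP θ.L j.1.1.1.1.Ω (j.1.1.1.1.Λs m) l) := by
  obtain ⟨B₀, B₀β, cP, hB₀, hB₀β, hcP, H⟩ := sockB9P3H2_topCube_idxB8SubD θ hD M hρ hk hβ hlen
  obtain ⟨j, -, hkk, hΩ, -⟩ := exists_idxB8SubD_cubeFam θ a M hρ hk
  exact ⟨B₀, B₀β, cP, hB₀, hB₀β, hcP, j, hΩ, hkk, H a j hΩ hkk⟩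

/-! ## §3 One triple of constants for all depths `k ≤ K` (a programme of bounded depth) -/

/-- **`SockB9P3H2` is monotone in its constants** (`B₀ ≤ B₀′`, `B₀β ≤ B₀β′`, `cP′ ≤ cP`; `η ≥ 0` so that the right-hand side `|J|₍₋₃₎ + |B₁|` is non-negative).
[cite: Balaban1985RegularSpaces, (1.59) p.86] -/
theorem sockB9P3H2_mono {𝔹 : Type*} [CStarAlgebra 𝔹] [Nontrivial 𝔹] {L : ℕ} {B₀ B₀' B₀β B₀β' cP cP' β : ℝ} {len : Site d → ℝ} {η : ℝ}
    (hη : 0 ≤ η) (hB : B₀ ≤ B₀') (hBβ : B₀β ≤ B₀β') (hc : cP' ≤ cP) {k : ℕ} {Ω : ℕ → Set (Site d)} {Λs : ℕ → ℕ → Set (Site d)}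
    {Λb : ℕ → ℕ → Set (Site d × Fin d)} (S : SockB9P3H2 (𝔸 := 𝔹) L B₀ B₀β cP β len η k Ω Λs Λb) :
    SockB9P3H2 (𝔸 := 𝔹) L B₀' B₀β' cP' β len η k Ω Λs Λb := by
  intro α₀ α₂ hα₀ hα₀c hα₂ hα₂c U₀ W hU₀ hW hAk hAkW hLan A' hsa h41 hA0
  obtain ⟨l1, l2, l3, l4, l5⟩ := S α₀ α₂ hα₀ (hα₀c.trans hc) hα₂ (hα₂c.trans hc) U₀ W hU₀ hW hAk hAkW hLan A' hsa h41 hA0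
  have hR : 0 ≤ bondNorm L k η (-(3 : ℝ)) Ω (fun x μ => Jcur η U₀ A' μ x)
      + wsup 1 (fun p : {p : ℕ × (Site d × Fin d) // p.1 ≤ k ∧ p.2 ∈ Λb k p.1} => linCovIter L U₀ (iEta η A') p.1.1 p.1.2.1 p.1.2.2) :=
    add_nonneg (B8ScaledSupNorm.msup_nonneg L k hη _ _ _) (B8Eq155JBound.wsup_nonneg zero_le_one _)
  exact ⟨l1.trans (mul_le_mul_of_nonneg_right hB hR), l2.trans (mul_le_mul_of_nonneg_right hB hR), l3.trans (mul_le_mul_of_nonneg_right hB hR),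
    l4.trans (mul_le_mul_of_nonneg_right hB hR), l5.trans (mul_le_mul_of_nonneg_right hBβ hR)⟩

/-- ★★ **ONE TRIPLE OF CONSTANTS FOR ALL DEPTHS `1 ≤ k ≤ K`** (finite maximum over the depths of a programme of bounded depth; the constants DEPEND ON `K` — a
bookkeeping consequence, NOT [4] Thm 3.3's depth-uniform `B₀(d, L)`): for every law member over a top-cube tower `(T, □₁(a), …, □_k(a))` of shape `(M, ρ)` and depth
`k ≤ K` the `SB9P` body holds with the same `(B₀, B₀β, cP)`. [cite: Balaban1985RegularSpaces, (1.59) p.86, (1.131) p.99; Balaban1985BackgroundPropagators, Thm 3.3 p.399] -/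
theorem sockB9P3H2_topCube_lawMember_depth (θ : Stage3Params) [FiniteDimensional ℂ θ.𝔸] (hD : 2 ≤ θ.D) (M : ℕ) {ρ : ℕ} (hρ : θ.L ≤ ρ)
    {β : ℝ} (hβ : 0 ≤ β) {len : Site θ.D → ℝ} (hlen : ∀ z : Site θ.D, z ≠ 0 → 1 ≤ len z) :
    ∀ K : ℕ, ∃ B₀ B₀β cP : ℝ, 0 < B₀ ∧ 0 < B₀β ∧ 0 < cP ∧ ∀ k, 1 ≤ k → k ≤ K →
      ∀ (a : Site θ.D) (i : ZdIdx θ.D θ.L), i.Ω = cubeFam true θ.L a M ρ k → i.k = k →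
      IdxB8Laws θ.L i → DomainSeq θ.L i.Ω → (∀ l, l < i.k → ∀ z ∈ i.Λs i.k l, ((θ.L : ℤ) ^ l) • z ∈ Lam θ.L i.Ω l) →
        SockB9P3H2 (𝔸 := θ.𝔸) θ.L B₀ B₀β cP β len i.η i.k i.Ω i.Λs (fun m j => towerBondsP θ.L i.Ω (i.Λs m) j)
  | 0 => ⟨1, 1, 1, one_pos, one_pos, one_pos, fun k h1 h0 => by omega⟩
  | K + 1 => by
    obtain ⟨B₁, B₁β, c₁, hB₁, hB₁β, hc₁, H₁⟩ := sockB9P3H2_topCube_lawMember_depth θ hD M hρ hβ hlen K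
    obtain ⟨B₂, B₂β, c₂, hB₂, hB₂β, hc₂, H₂⟩ := sockB9P3H2_topCube_lawMember θ hD M hρ (k := K + 1) (by omega) hβ hlen
    refine ⟨max B₁ B₂, max B₁β B₂β, min c₁ c₂, lt_max_of_lt_left hB₁, lt_max_of_lt_left hB₁β, lt_min hc₁ hc₂,
      fun k h1 hk a i hΩ hkk hlaws hdom h15 => ?_⟩
    rcases Nat.lt_or_ge k (K + 1) with hlt | hge
    · exact sockB9P3H2_mono i.hη.le (le_max_left _ _) (le_max_left _ _) (min_le_left _ _) (H₁ k h1 (by omega) a i hΩ hkk hlaws hdom h15)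
    · have hkK : k = K + 1 := le_antisymm hk hge
      subst hkK
      exact sockB9P3H2_mono i.hη.le (le_max_right _ _) (le_max_right _ _) (min_le_right _ _) (H₂ a i hΩ hkk hlaws hdom h15)

end Literature.MathematicalPhysics.QuantumFieldTheory.Balaban1983to89.B8SockB9P3H2AtTopCubeTowerMember

end
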